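import Summits.Ventures.CertifiedArithmetic.LowPrec.GemmFirstRegimeGridLaw
import Summits.Ventures.CertifiedArithmetic.LowPrec.GemmWorstCaseE2M3Prec
import Summits.Ventures.CertifiedArithmetic.LowPrec.GemmWorstCaseE3M2Prec
import HarnessLib

/-!
# GEMM worst case LXII-c — ROWS of `W_p(n)` in the first regime: the generic row engine and the
# FP6 alphabets E2M3², E3M2² (every precision; binary32 in integers)

HONEST FRAMING: certified error envelopes and provably optimal rounding/accumulation schemes for
low-precision formats under stated cost models; every table by two implementations; no hardware or
vendor claims.

Files LXII-a/b (`GemmFirstRegimeGrid`, `GemmFirstRegimeGridLaw`) decide the first regime of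
sequential round-to-nearest-even accumulation of ANY word over a dyadic grid alphabet `(G, M, m₀)`
into ANY format of precision `p = manBits + 1` (`T = 2^p`).  This file turns them into ROWS of a
worst-case function `W` that is only assumed to be the attained maximum of the relative error over
the words of an alphabet `L` (`hWle`, `hWge`) whose letters are grid letters (`hL`):

* `gridW_eq_zero` (i): `W(n) = 0` whenever `M(n-1) + m₀ < T`;
* `gridW_le_firstRegime` (ii): `W(n₀+k) ≤ k/(T+k) = ku/(1+ku)` for `k ≤ 2^(p-1)`, `n₀ = j₀+1`;
* `le_gridW_entry`, `le_gridW_late`, `le_gridW_plateau` (iv): the entry-word families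
  `(k)/(T+4e+k)`, `(k-1)/(T+k-1)`, `k/(M n₀ + k)` from below;
* `gridW_firstRegime` (iii): EQUALITY `W(n₀+k) = k/(T+k)`, `1 ≤ k ≤ 2^(p-1)`, as soon as three
  letters `A, B, C` spell `A + B + M(n₀-2) + C = T + 1`.

Then the two FP6 product alphabets of [RouhaniEtAl2023MX, Table 1] (`W⁶ = worstRelErrE2M3`,
`W⁸ = worstRelErrE3M2` of files XLVI/XLVII), under exactly the hypotheses of the θ-law theorems
`worst6P_sandwich` / `worst8P_sandwich` (so the first and the last regime of the same `W_φ` are now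
both theorems for every admissible `φ`):

* E2M3²: grid `2^-6`, `M = 3600 = 60²`, `m₀ = 225 = 15²`; binary32: `W⁶_24(n) = 0` iff `n ≤ 4661`
  and `W⁶_24(4661+k) = k/(2^24+k)` for `1 ≤ k ≤ 2^23` (entry word `1152, 65, 3600^{×4659}, 3600`).
* E3M2²: grid `2^-8`, `M = 200704 = 28²·2^8`, `m₀ = 49`; binary32: `W⁸_24(n) = 0` iff `n ≤ 84` and
  `W⁸_24(84+k) = k/(2^24+k)` for `1 ≤ k ≤ 2^23` (entry word `172032, 147456, 200704^{×82}, 1`).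

The mixed alphabets are file LXII-d.  Second implementation: `code/gemm/firstregime/` (C2, exact
rational DP, rows `certs/gemm/firstregime/`).
References: [BoldoEtAl2023, Thm 4.5], [LangeRump2019], [Higham2002, §4.2], [RouhaniEtAl2023MX,
Table 1], [IEEE7542019, §4.3.1].
-/

namespace Summit.Ventures.CertifiedArithmetic.LowPrec.Gemm

open Literature.ComputerArithmetic.FloatingPoint
open Literature.ComputerArithmetic.FloatingPoint.MiniFloat
open Finset

/-! ### The row engine: `W` = the attained maximum over words of a grid alphabet `L` -/

section Rows

variable {G M m0 E : ℕ} {φ : Format} {L : ℚ → Prop} {W : ℕ → ℚ}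
variable
  (hL : ∀ q, L q → ∃ z : ℤ, q = (z : ℚ) / 2 ^ G ∧ z.natAbs ≤ M ∧ (z % 2 = 0 ∨ z.natAbs ≤ m0))
  (hWle : ∀ x : ℕ → ℚ, (∀ j, L (x j)) → ∀ m, relErr φ x m ≤ W m)
  (hWge : ∀ m, ∃ x : ℕ → ℚ, (∀ j, L (x j)) ∧ W m = relErr φ x m)
  (hq : φ.qexp ≤ -(G : ℤ)) (hR : (2 : ℚ) ^ (φ.manBits + E + 3) ≤ φ.maxRat)
  (hm0M : m0 ≤ M) (hMT : M ≤ 2 ^ (φ.manBits + 1)) (hm0 : 1 ≤ m0) (hME : M ≤ 2 ^ (G + E))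
  (hMev : M % 2 = 0)

include hL hWge hq hR hm0M hMT in
/-- (i) THE EXACT RANGE: `W(m+1) = 0` whenever `M m + m₀ < T`. [cell, gemm.tex Prop. p:fpA (i)] -/
theorem gridW_eq_zero {m : ℕ} (h : M * m + m0 < 2 ^ (φ.manBits + 1)) : W m = 0 := by
  obtain ⟨x, hx, hW⟩ := hWge m
  rw [hW]
  exact relErr_eq_zero_prefixG (fun j => hL _ (hx j)) hq hR hm0M hMT h

include hL hWge hq hR hm0M hMT hm0 hME in
/-- (ii) THE RESTART BOUND: `W(j₀+1+k) ≤ k/(T+k) = ku/(1+ku)` for `k ≤ 2^(p-1)` when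
`M j₀ + m₀ < T`. [cell, gemm.tex Prop. p:fpA (ii); cite: BoldoEtAl2023, Thm 4.5] -/
theorem gridW_le_firstRegime {j0 : ℕ} (hj0 : M * j0 + m0 < 2 ^ (φ.manBits + 1)) {k : ℕ}
    (hk : k ≤ 2 ^ φ.manBits) : W (j0 + k) ≤ (k : ℚ) / (2 ^ (φ.manBits + 1) + k) := by
  obtain ⟨x, hx, hW⟩ := hWge (j0 + k)
  rw [hW]
  exact relErr_le_firstRegimeG (fun j => hL _ (hx j)) hq hR hm0M hMT hm0 hME hj0 hk

include hL hWle hq hR hm0M hMT hm0 hMev in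
/-- (iv-a) THE (DEFICIENT) ENTRY ROW: letters `A, B, C` with `A + B + Mj + C = T + 4e + 1` give
`(d+1)/(T + 4e + d + 1) ≤ W(j+3+d)`; `e = 0` is attainment. [cell, gemm.tex Prop. p:fpA (iii,iv)] -/
theorem le_gridW_entry {j A B C e : ℕ} (hA : L ((A : ℚ) / 2 ^ G)) (hB : L ((B : ℚ) / 2 ^ G))
    (hC : L ((C : ℚ) / 2 ^ G)) (hM : L ((M : ℚ) / 2 ^ G)) (h1 : L (1 / 2 ^ G))
    (hj : M * (j + 1) + m0 < 2 ^ (φ.manBits + 1)) (he : 4 * e < 2 ^ (φ.manBits + 1))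
    (hsum : A + B + M * j + C = 2 ^ (φ.manBits + 1) + 4 * e + 1) (d : ℕ) :
    ((d + 1 : ℕ) : ℚ) / (2 ^ (φ.manBits + 1) + 4 * e + ((d + 1 : ℕ) : ℚ)) ≤ W (j + 2 + d) := by
  rw [← relErr_ew3_deficient hq hR hm0M hMT hm0 hMev (facts_nat_of (hL _ hA))
    (facts_nat_of (hL _ hB)) (facts_nat_of (hL _ hC)) hj he hsum d]
  exact hWle _ (ew3_forall hA hB hM hC h1) _

include hL hWle hq hR hm0M hMT hm0 hMev in
/-- (iv-b) THE LATE ENTRY ROW: `A + B + Mj + C = T` gives `d/(T+d) ≤ W(j+3+d)`.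
[cell, gemm.tex Prop. p:fpA (iv)] -/
theorem le_gridW_late {j A B C : ℕ} (hA : L ((A : ℚ) / 2 ^ G)) (hB : L ((B : ℚ) / 2 ^ G))
    (hC : L ((C : ℚ) / 2 ^ G)) (hM : L ((M : ℚ) / 2 ^ G)) (h1 : L (1 / 2 ^ G))
    (hj : M * (j + 1) + m0 < 2 ^ (φ.manBits + 1)) (hsum : A + B + M * j + C = 2 ^ (φ.manBits + 1))
    (d : ℕ) : (d : ℚ) / (2 ^ (φ.manBits + 1) + d) ≤ W (j + 2 + d) := by
  rw [← relErr_ew3_late hq hR hm0M hMT hm0 hMev (facts_nat_of (hL _ hA))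
    (facts_nat_of (hL _ hB)) (facts_nat_of (hL _ hC)) hj hsum d]
  exact hWle _ (ew3_forall hA hB hM hC h1) _

include hWle hq hR hm0M hMT hm0 hMev in
/-- (iv-c) THE PLATEAU ROW: `M^{×(j+2)}, 1, 1, …` with `T ≤ M(j+2)` gives
`(d+1)/(M(j+2) + d + 1) ≤ W(j+3+d)` — the zero range is sharp. [cell, gemm.tex Prop. p:fpA (i)] -/
theorem le_gridW_plateau {j : ℕ} (hM : L ((M : ℚ) / 2 ^ G)) (h1 : L (1 / 2 ^ G))
    (hj : M * (j + 1) + m0 < 2 ^ (φ.manBits + 1)) (hT : 2 ^ (φ.manBits + 1) ≤ M * (j + 2))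
    (h4 : 4 ∣ M) (d : ℕ) :
    ((d + 1 : ℕ) : ℚ) / ((M * (j + 2) : ℕ) + ((d + 1 : ℕ) : ℚ)) ≤ W (j + 2 + d) := by
  rw [← relErr_ew3_plateau hq hR hm0M hMT hm0 hMev hj hT h4 d]
  exact hWle _ (ew3_forall hM hM hM (by simpa using h1) h1) _

include hL hWle hWge hq hR hm0M hMT hm0 hME hMev in
/-- (iii) THE LAW OF THE FIRST REGIME: if letters `A, B, C` spell `A + B + Mj + C = T + 1` with
`M(j+1) + m₀ < T`, then `W(j+2+k) = k/(T+k)` for `1 ≤ k ≤ 2^(p-1)` (`n₀ = j+2`).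
[cell, gemm.tex Prop. p:fpA (iii); cite: BoldoEtAl2023, Thm 4.5] -/
theorem gridW_firstRegime {j A B C : ℕ} (hA : L ((A : ℚ) / 2 ^ G)) (hB : L ((B : ℚ) / 2 ^ G))
    (hC : L ((C : ℚ) / 2 ^ G)) (hM : L ((M : ℚ) / 2 ^ G)) (h1 : L (1 / 2 ^ G))
    (hj : M * (j + 1) + m0 < 2 ^ (φ.manBits + 1)) (hsum : A + B + M * j + C = 2 ^ (φ.manBits + 1) + 1)
    {k : ℕ} (hk : 1 ≤ k) (hk' : k ≤ 2 ^ φ.manBits) :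
    W (j + 1 + k) = (k : ℚ) / (2 ^ (φ.manBits + 1) + k) := by
  refine le_antisymm (gridW_le_firstRegime hL hWge hq hR hm0M hMT hm0 hME hj hk') ?_
  obtain ⟨d, rfl⟩ : ∃ d, k = d + 1 := ⟨k - 1, by omega⟩
  have h := le_gridW_entry hL hWle hq hR hm0M hMT hm0 hMev (e := 0) hA hB hC hM h1 hj (by simp)
    (by omega) d
  rw [show j + 1 + (d + 1) = j + 2 + d by ring]
  simpa using h

end Rows

/-! ### E2M3²: grid `2^-6`, `M = 3600`, `m₀ = 225` -/

/-- Integer letter facts of `Λ(E2M3²)` (443 letters): modulus `≤ 3600 = 60²`, odd letters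
`≤ 225 = 15²`. [cell, kernel] -/
theorem lamE2M3_facts :
    ∀ z ∈ ThetaE2M3.lamG, z.natAbs ≤ 3600 ∧ (z % 2 = 0 ∨ z.natAbs ≤ 225) := by decide +kernel

/-- … on values: every letter of `piE2M3` is a grid letter of `(6, 3600, 225)`. [cell] -/
theorem piE2M3_grid : ∀ q, q ∈ piE2M3 →
    ∃ z : ℤ, q = (z : ℚ) / 2 ^ 6 ∧ z.natAbs ≤ 3600 ∧ (z % 2 = 0 ∨ z.natAbs ≤ 225) := by
  intro q hq
  obtain ⟨Q, hQ, hQq⟩ := exists_of_mem_piE2M3 hq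
  exact ⟨Q, hQq.symm, lamE2M3_facts Q hQ⟩

/-- A natural letter by its index fact. [cell] -/
theorem mem_piE2M3_nat {A : ℕ} (hA : (A : ℤ) ∈ ThetaE2M3.lamG) : ((A : ℕ) : ℚ) / 2 ^ 6 ∈ piE2M3 :=
  List.mem_map.mpr ⟨(A : ℤ), hA, by simp⟩

/-- `W⁶_φ` is the attained maximum over words of `piE2M3`. [cell] -/
theorem worst6P_spec (φ : Format) :
    (∀ x : ℕ → ℚ, (∀ j, x j ∈ piE2M3) → ∀ m, relErr φ x m ≤ worstRelErrE2M3 φ m) ∧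
    (∀ m, ∃ x : ℕ → ℚ, (∀ j, x j ∈ piE2M3) ∧ worstRelErrE2M3 φ m = relErr φ x m) := by
  refine ⟨fun x hx m => relErr_le_worst6P φ x hx m, fun m => ?_⟩
  obtain ⟨w, -, hw⟩ := exists_mem_eq_sup'
    (univ_nonempty : (univ : Finset (Fin (m + 1) → Fin 443)).Nonempty)
    (fun w => relErr φ (wordInputE2M3 w) m)
  exact ⟨wordInputE2M3 w, wordInputE2M3_mem w, hw⟩

section E2M3

variable {φ : Format} (hm : 11 ≤ φ.manBits) (hq : φ.qexp ≤ -6)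
  (hR : (2 : ℚ) ^ (φ.manBits + 14) ≤ φ.maxRat)
include hm hq hR

omit hq hR in
/-- `M = 3600 ≤ T` iff `p ≥ 12`. [cell] -/
theorem e2m3_MT : 3600 ≤ 2 ^ (φ.manBits + 1) :=
  le_trans (by norm_num) (Nat.pow_le_pow_right (by norm_num) (by omega : 12 ≤ φ.manBits + 1))

/-- (i) E2M3², every `p ≥ 12`: `W⁶_φ(m+1) = 0` whenever `3600 m + 225 < 2^p`. [cell] -/
theorem worst6P_eq_zero {m : ℕ} (h : 3600 * m + 225 < 2 ^ (φ.manBits + 1)) :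
    worstRelErrE2M3 φ m = 0 :=
  gridW_eq_zero piE2M3_grid (worst6P_spec φ).2 hq (E := 11) hR (by norm_num) (e2m3_MT hm) h

/-- (ii) E2M3², every `p ≥ 12`: `W⁶_φ(j₀+1+k) ≤ k/(2^p+k)`, `k ≤ 2^(p-1)`, `3600 j₀ + 225 < 2^p`.
[cell; cite: BoldoEtAl2023, Thm 4.5] -/
theorem worst6P_le_firstRegime {j0 : ℕ} (hj0 : 3600 * j0 + 225 < 2 ^ (φ.manBits + 1)) {k : ℕ}
    (hk : k ≤ 2 ^ φ.manBits) :
    worstRelErrE2M3 φ (j0 + k) ≤ (k : ℚ) / (2 ^ (φ.manBits + 1) + k) :=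
  gridW_le_firstRegime piE2M3_grid (worst6P_spec φ).2 hq (E := 11) hR (by norm_num) (e2m3_MT hm)
    (by norm_num) (by norm_num) hj0 hk

/-- (iv-a) E2M3²: the entry row from letters `A + B + 3600 j + C = 2^p + 4e + 1`. [cell] -/
theorem le_worst6P_entry {j A B C e : ℕ} (hA : (A : ℤ) ∈ ThetaE2M3.lamG)
    (hB : (B : ℤ) ∈ ThetaE2M3.lamG) (hC : (C : ℤ) ∈ ThetaE2M3.lamG)
    (hj : 3600 * (j + 1) + 225 < 2 ^ (φ.manBits + 1)) (he : 4 * e < 2 ^ (φ.manBits + 1))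
    (hsum : A + B + 3600 * j + C = 2 ^ (φ.manBits + 1) + 4 * e + 1) (d : ℕ) :
    ((d + 1 : ℕ) : ℚ) / (2 ^ (φ.manBits + 1) + 4 * e + ((d + 1 : ℕ) : ℚ))
      ≤ worstRelErrE2M3 φ (j + 2 + d) :=
  le_gridW_entry piE2M3_grid (worst6P_spec φ).1 hq (E := 11) hR (by norm_num) (e2m3_MT hm)
    (by norm_num) (by norm_num) (mem_piE2M3_nat hA) (mem_piE2M3_nat hB) (mem_piE2M3_nat hC)
    (mem_piE2M3_nat (A := 3600) (by decide)) (by simpa using mem_piE2M3_nat (A := 1) (by decide))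
    hj he hsum d

/-- (iv-b) E2M3²: the late row from letters `A + B + 3600 j + C = 2^p`. [cell] -/
theorem le_worst6P_late {j A B C : ℕ} (hA : (A : ℤ) ∈ ThetaE2M3.lamG)
    (hB : (B : ℤ) ∈ ThetaE2M3.lamG) (hC : (C : ℤ) ∈ ThetaE2M3.lamG)
    (hj : 3600 * (j + 1) + 225 < 2 ^ (φ.manBits + 1))
    (hsum : A + B + 3600 * j + C = 2 ^ (φ.manBits + 1)) (d : ℕ) :
    (d : ℚ) / (2 ^ (φ.manBits + 1) + d) ≤ worstRelErrE2M3 φ (j + 2 + d) :=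
  le_gridW_late piE2M3_grid (worst6P_spec φ).1 hq (E := 11) hR (by norm_num) (e2m3_MT hm)
    (by norm_num) (by norm_num) (mem_piE2M3_nat hA) (mem_piE2M3_nat hB) (mem_piE2M3_nat hC)
    (mem_piE2M3_nat (A := 3600) (by decide)) (by simpa using mem_piE2M3_nat (A := 1) (by decide))
    hj hsum d

/-- (iv-c) E2M3²: the plateau row `(d+1)/(3600(j+2) + d + 1) ≤ W⁶_φ(j+3+d)` when
`3600(j+1) + 225 < 2^p ≤ 3600(j+2)`. [cell] -/
theorem le_worst6P_plateau {j : ℕ} (hj : 3600 * (j + 1) + 225 < 2 ^ (φ.manBits + 1))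
    (hT : 2 ^ (φ.manBits + 1) ≤ 3600 * (j + 2)) (d : ℕ) :
    ((d + 1 : ℕ) : ℚ) / ((3600 * (j + 2) : ℕ) + ((d + 1 : ℕ) : ℚ)) ≤ worstRelErrE2M3 φ (j + 2 + d) :=
  le_gridW_plateau (worst6P_spec φ).1 hq (E := 11) hR (m0 := 225) (by norm_num) (e2m3_MT hm)
    (by norm_num) (by norm_num) (mem_piE2M3_nat (A := 3600) (by decide))
    (by simpa using mem_piE2M3_nat (A := 1) (by decide)) hj hT (by norm_num) d

/-- (iii) E2M3², every `p ≥ 12` in which letters spell `A + B + 3600 j + C = 2^p + 1`: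
`W⁶_φ(j+2+k) = k/(2^p+k)` for `1 ≤ k ≤ 2^(p-1)`. [cell; cite: BoldoEtAl2023, Thm 4.5] -/
theorem worst6P_firstRegime {j A B C : ℕ} (hA : (A : ℤ) ∈ ThetaE2M3.lamG)
    (hB : (B : ℤ) ∈ ThetaE2M3.lamG) (hC : (C : ℤ) ∈ ThetaE2M3.lamG)
    (hj : 3600 * (j + 1) + 225 < 2 ^ (φ.manBits + 1))
    (hsum : A + B + 3600 * j + C = 2 ^ (φ.manBits + 1) + 1) {k : ℕ} (hk : 1 ≤ k)
    (hk' : k ≤ 2 ^ φ.manBits) :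
    worstRelErrE2M3 φ (j + 1 + k) = (k : ℚ) / (2 ^ (φ.manBits + 1) + k) :=
  gridW_firstRegime piE2M3_grid (worst6P_spec φ).1 (worst6P_spec φ).2 hq (E := 11) hR
    (by norm_num) (e2m3_MT hm) (by norm_num) (by norm_num) (by norm_num) (mem_piE2M3_nat hA)
    (mem_piE2M3_nat hB) (mem_piE2M3_nat hC) (mem_piE2M3_nat (A := 3600) (by decide))
    (by simpa using mem_piE2M3_nat (A := 1) (by decide)) hj hsum hk hk'

end E2M3

/-- E2M3² INTO binary32 (`p = 24`): `W⁶_24(n) = 0` for `n ≤ 4661 = n₀`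
(`3600·4660 + 225 < 2^24`). [cell, gemm.tex Prop. p:fpA; C2 cross-check certs/gemm/firstregime/] -/
theorem worst6P_Binary32_eq_zero {m : ℕ} (hm : m ≤ 4660) : worstRelErrE2M3 Format.Binary32 m = 0 := by
  obtain ⟨h1, h2, h3, h4⟩ := Binary32_hyps6
  have hT : 2 ^ (Format.Binary32.manBits + 1) = 16777216 := by rw [pow_succ, h4]; norm_num
  exact worst6P_eq_zero h1 h2 h3 (by omega)

/-- E2M3² INTO binary32: `W⁶_24(4661 + k) = k/(2^24 + k)` for `1 ≤ k ≤ 2^23` — the law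
`ku/(1+ku)` from the first inexact length on, attained by `1152, 65, 3600^{×4659}, 3600, 1^{×(k-1)}`
(`1152 + 65 + 3600·4660 = 2^24 + 1`). [cell, gemm.tex Prop. p:fpA] -/
theorem worst6P_Binary32_firstRegime {k : ℕ} (hk : 1 ≤ k) (hk' : k ≤ 2 ^ 23) :
    worstRelErrE2M3 Format.Binary32 (4660 + k) = (k : ℚ) / (2 ^ 24 + k) := by
  obtain ⟨h1, h2, h3, h4⟩ := Binary32_hyps6
  have hT : 2 ^ (Format.Binary32.manBits + 1) = 16777216 := by rw [pow_succ, h4]; norm_num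
  have hk'' : k ≤ 2 ^ Format.Binary32.manBits := hk'
  have h := worst6P_firstRegime h1 h2 h3 (j := 4659) (A := 1152) (B := 65) (C := 3600)
    (by decide) (by decide) (by decide) (by omega) (by omega) hk hk''
  rw [show 4659 + 1 + k = 4660 + k by ring, show Format.Binary32.manBits + 1 = 24 from rfl] at h
  exact h

/-! ### E3M2²: grid `2^-8`, `M = 200704`, `m₀ = 49` -/

/-- Integer letter facts of `Λ(E3M2²)` (291 letters): modulus `≤ 200704 = 28²·2^8`, odd letters
`≤ 49 = 7²`. [cell, kernel] -/
theorem lamE3M2_facts :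
    ∀ z ∈ ThetaE3M2.lamG, z.natAbs ≤ 200704 ∧ (z % 2 = 0 ∨ z.natAbs ≤ 49) := by decide +kernel

/-- … on values: every letter of `piE3M2` is a grid letter of `(8, 200704, 49)`. [cell] -/
theorem piE3M2_grid : ∀ q, q ∈ piE3M2 →
    ∃ z : ℤ, q = (z : ℚ) / 2 ^ 8 ∧ z.natAbs ≤ 200704 ∧ (z % 2 = 0 ∨ z.natAbs ≤ 49) := by
  intro q hq
  obtain ⟨Q, hQ, hQq⟩ := exists_of_mem_piE3M2 hq
  exact ⟨Q, hQq.symm, lamE3M2_facts Q hQ⟩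

/-- A natural letter by its index fact. [cell] -/
theorem mem_piE3M2_nat {A : ℕ} (hA : (A : ℤ) ∈ ThetaE3M2.lamG) : ((A : ℕ) : ℚ) / 2 ^ 8 ∈ piE3M2 :=
  List.mem_map.mpr ⟨(A : ℤ), hA, by simp⟩

/-- `W⁸_φ` is the attained maximum over words of `piE3M2`. [cell] -/
theorem worst8P_spec (φ : Format) :
    (∀ x : ℕ → ℚ, (∀ j, x j ∈ piE3M2) → ∀ m, relErr φ x m ≤ worstRelErrE3M2 φ m) ∧
    (∀ m, ∃ x : ℕ → ℚ, (∀ j, x j ∈ piE3M2) ∧ worstRelErrE3M2 φ m = relErr φ x m) := by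
  refine ⟨fun x hx m => relErr_le_worst8P φ x hx m, fun m => ?_⟩
  obtain ⟨w, -, hw⟩ := exists_mem_eq_sup'
    (univ_nonempty : (univ : Finset (Fin (m + 1) → Fin 291)).Nonempty)
    (fun w => relErr φ (wordInputE3M2 w) m)
  exact ⟨wordInputE3M2 w, wordInputE3M2_mem w, hw⟩

section E3M2

variable {φ : Format} (hm : 17 ≤ φ.manBits) (hq : φ.qexp ≤ -8)
  (hR : (2 : ℚ) ^ (φ.manBits + 20) ≤ φ.maxRat)
include hm hq hR

omit hq hR in
/-- `M = 200704 ≤ T` iff `p ≥ 18`. [cell] -/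
theorem e3m2_MT : 200704 ≤ 2 ^ (φ.manBits + 1) :=
  le_trans (by norm_num) (Nat.pow_le_pow_right (by norm_num) (by omega : 18 ≤ φ.manBits + 1))

/-- (i) E3M2², every `p ≥ 18`: `W⁸_φ(m+1) = 0` whenever `200704 m + 49 < 2^p`. [cell] -/
theorem worst8P_eq_zero {m : ℕ} (h : 200704 * m + 49 < 2 ^ (φ.manBits + 1)) :
    worstRelErrE3M2 φ m = 0 :=
  gridW_eq_zero piE3M2_grid (worst8P_spec φ).2 hq (E := 17) hR (by norm_num) (e3m2_MT hm) h

/-- (ii) E3M2², every `p ≥ 18`: `W⁸_φ(j₀+1+k) ≤ k/(2^p+k)`, `k ≤ 2^(p-1)`, `200704 j₀ + 49 < 2^p`.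
[cell; cite: BoldoEtAl2023, Thm 4.5] -/
theorem worst8P_le_firstRegime {j0 : ℕ} (hj0 : 200704 * j0 + 49 < 2 ^ (φ.manBits + 1)) {k : ℕ}
    (hk : k ≤ 2 ^ φ.manBits) :
    worstRelErrE3M2 φ (j0 + k) ≤ (k : ℚ) / (2 ^ (φ.manBits + 1) + k) :=
  gridW_le_firstRegime piE3M2_grid (worst8P_spec φ).2 hq (E := 17) hR (by norm_num) (e3m2_MT hm)
    (by norm_num) (by norm_num) hj0 hk

/-- (iv-a) E3M2²: the entry row from letters `A + B + 200704 j + C = 2^p + 4e + 1`. [cell] -/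
theorem le_worst8P_entry {j A B C e : ℕ} (hA : (A : ℤ) ∈ ThetaE3M2.lamG)
    (hB : (B : ℤ) ∈ ThetaE3M2.lamG) (hC : (C : ℤ) ∈ ThetaE3M2.lamG)
    (hj : 200704 * (j + 1) + 49 < 2 ^ (φ.manBits + 1)) (he : 4 * e < 2 ^ (φ.manBits + 1))
    (hsum : A + B + 200704 * j + C = 2 ^ (φ.manBits + 1) + 4 * e + 1) (d : ℕ) :
    ((d + 1 : ℕ) : ℚ) / (2 ^ (φ.manBits + 1) + 4 * e + ((d + 1 : ℕ) : ℚ))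
      ≤ worstRelErrE3M2 φ (j + 2 + d) :=
  le_gridW_entry piE3M2_grid (worst8P_spec φ).1 hq (E := 17) hR (by norm_num) (e3m2_MT hm)
    (by norm_num) (by norm_num) (mem_piE3M2_nat hA) (mem_piE3M2_nat hB) (mem_piE3M2_nat hC)
    (mem_piE3M2_nat (A := 200704) (by decide)) (by simpa using mem_piE3M2_nat (A := 1) (by decide))
    hj he hsum d

/-- (iv-b) E3M2²: the late row from letters `A + B + 200704 j + C = 2^p`. [cell] -/
theorem le_worst8P_late {j A B C : ℕ} (hA : (A : ℤ) ∈ ThetaE3M2.lamG)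
    (hB : (B : ℤ) ∈ ThetaE3M2.lamG) (hC : (C : ℤ) ∈ ThetaE3M2.lamG)
    (hj : 200704 * (j + 1) + 49 < 2 ^ (φ.manBits + 1))
    (hsum : A + B + 200704 * j + C = 2 ^ (φ.manBits + 1)) (d : ℕ) :
    (d : ℚ) / (2 ^ (φ.manBits + 1) + d) ≤ worstRelErrE3M2 φ (j + 2 + d) :=
  le_gridW_late piE3M2_grid (worst8P_spec φ).1 hq (E := 17) hR (by norm_num) (e3m2_MT hm)
    (by norm_num) (by norm_num) (mem_piE3M2_nat hA) (mem_piE3M2_nat hB) (mem_piE3M2_nat hC)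
    (mem_piE3M2_nat (A := 200704) (by decide)) (by simpa using mem_piE3M2_nat (A := 1) (by decide))
    hj hsum d

/-- (iv-c) E3M2²: the plateau row when `200704(j+1) + 49 < 2^p ≤ 200704(j+2)`. [cell] -/
theorem le_worst8P_plateau {j : ℕ} (hj : 200704 * (j + 1) + 49 < 2 ^ (φ.manBits + 1))
    (hT : 2 ^ (φ.manBits + 1) ≤ 200704 * (j + 2)) (d : ℕ) :
    ((d + 1 : ℕ) : ℚ) / ((200704 * (j + 2) : ℕ) + ((d + 1 : ℕ) : ℚ))
      ≤ worstRelErrE3M2 φ (j + 2 + d) :=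
  le_gridW_plateau (worst8P_spec φ).1 hq (E := 17) hR (m0 := 49) (by norm_num) (e3m2_MT hm)
    (by norm_num) (by norm_num) (mem_piE3M2_nat (A := 200704) (by decide))
    (by simpa using mem_piE3M2_nat (A := 1) (by decide)) hj hT (by norm_num) d

/-- (iii) E3M2², every `p ≥ 18` in which letters spell `A + B + 200704 j + C = 2^p + 1`:
`W⁸_φ(j+2+k) = k/(2^p+k)` for `1 ≤ k ≤ 2^(p-1)`. [cell; cite: BoldoEtAl2023, Thm 4.5] -/
theorem worst8P_firstRegime {j A B C : ℕ} (hA : (A : ℤ) ∈ ThetaE3M2.lamG)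
    (hB : (B : ℤ) ∈ ThetaE3M2.lamG) (hC : (C : ℤ) ∈ ThetaE3M2.lamG)
    (hj : 200704 * (j + 1) + 49 < 2 ^ (φ.manBits + 1))
    (hsum : A + B + 200704 * j + C = 2 ^ (φ.manBits + 1) + 1) {k : ℕ} (hk : 1 ≤ k)
    (hk' : k ≤ 2 ^ φ.manBits) :
    worstRelErrE3M2 φ (j + 1 + k) = (k : ℚ) / (2 ^ (φ.manBits + 1) + k) :=
  gridW_firstRegime piE3M2_grid (worst8P_spec φ).1 (worst8P_spec φ).2 hq (E := 17) hR
    (by norm_num) (e3m2_MT hm) (by norm_num) (by norm_num) (by norm_num) (mem_piE3M2_nat hA)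
    (mem_piE3M2_nat hB) (mem_piE3M2_nat hC) (mem_piE3M2_nat (A := 200704) (by decide))
    (by simpa using mem_piE3M2_nat (A := 1) (by decide)) hj hsum hk hk'

end E3M2

/-- E3M2² INTO binary32 (`p = 24`): `W⁸_24(n) = 0` for `n ≤ 84 = n₀` (`200704·83 + 49 < 2^24`).
[cell, gemm.tex Prop. p:fpA; C2 cross-check certs/gemm/firstregime/] -/
theorem worst8P_Binary32_eq_zero {m : ℕ} (hm : m ≤ 83) : worstRelErrE3M2 Format.Binary32 m = 0 := by
  obtain ⟨h1, h2, h3, h4⟩ := Binary32_hyps8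
  have hT : 2 ^ (Format.Binary32.manBits + 1) = 16777216 := by rw [pow_succ, h4]; norm_num
  exact worst8P_eq_zero h1 h2 h3 (by omega)

/-- E3M2² INTO binary32: `W⁸_24(84 + k) = k/(2^24 + k)` for `1 ≤ k ≤ 2^23`, attained by
`172032, 147456, 200704^{×82}, 1, 1^{×(k-1)}` (`172032 + 147456 + 200704·82 + 1 = 2^24 + 1`; no two
letters enter the binade at `2^24 + 1`, hence the three-letter entry words of file LXII-b).
[cell, gemm.tex Prop. p:fpA] -/
theorem worst8P_Binary32_firstRegime {k : ℕ} (hk : 1 ≤ k) (hk' : k ≤ 2 ^ 23) :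
    worstRelErrE3M2 Format.Binary32 (83 + k) = (k : ℚ) / (2 ^ 24 + k) := by
  obtain ⟨h1, h2, h3, h4⟩ := Binary32_hyps8
  have hT : 2 ^ (Format.Binary32.manBits + 1) = 16777216 := by rw [pow_succ, h4]; norm_num
  have hk'' : k ≤ 2 ^ Format.Binary32.manBits := hk'
  have h := worst8P_firstRegime h1 h2 h3 (j := 82) (A := 172032) (B := 147456) (C := 1)
    (by decide) (by decide) (by decide) (by omega) (by omega) hk hk''
  rw [show 82 + 1 + k = 83 + k by ring, show Format.Binary32.manBits + 1 = 24 from rfl] at h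
  exact h

end Summit.Ventures.CertifiedArithmetic.LowPrec.Gemm
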